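import Summits.ResolutionOfSingularities.ResolutionOfSingularities.Theorems.FrobeniusLadderFRationalResolutionHomogeneousUnits
import Mathlib.LinearAlgebra.FreeModule.Basic
import Mathlib.LinearAlgebra.Span.Defs
import HarnessLib

/-!
# Crux `FrobeniusLadder.FRationalResolution` (stmt-ResolutionOfSingularities-15317), line `redirect`,
# stub `stub_diagonalizableQuotientResolution` — census item R3-p, first brick: a MULTIPLICATIVE
# choice of homogeneous units of prescribed degrees along a free lattice (the twisting units
# `λ(m)` of the degree-zero chart `ψ(m) = x^m · λ(m)` at a non-fixed point)

At a non-fixed point `𝔔` of the quotient chart (unit-degree subgroup `B = B_𝔔`, global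
homogeneous units of all degrees `b ∈ B` after `…AwayUnits`), the monomial chart `m ↦ x^m` of a
homogeneous regular system of parameters lands in `S^{(B)}`, not in `S₀`; the recipe of the
repair census (leafhand-3 g0, item R3-p — the only route at WILD points `p ∣ |B|`, where the
Kummer cover is inseparable) twists it by units: `ψ(m) = x^m · λ(m)` with `λ` a GROUP
HOMOMORPHISM from the (free) exponent lattice to homogeneous units of the opposite degrees. This
file supplies `λ`:

* `exists_unitHom_mem_grade` — for a graded algebra `T` (grading group `B`), a free `ℤ`-module
  `M`, and an additive `d : M → B` such that every degree `d m` carries a homogeneous unit, there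
  is a group homomorphism `λ : M → Tˣ` (written additively into `Additive Tˣ`) with
  `λ(m) ∈ T_{d m}` for all `m` (choose units on a basis, extend by freeness; the set of `m` with
  `λ(m) ∈ T_{d m}` is a subgroup since inverses of homogeneous units are homogeneous of opposite
  degree, `HomogeneousUnits.inv_mem_of_isUnit`).

Honest label: brick of R3-p (no stub closed; the twisted chart and the faithfully flat descent
of Kato's (2.1) are not here). No definitions, no named facts, no sorry.
[folklore; cite: SGA3, Exp. VIII §4–5]
-/

noncomputable section

-- single-problem summit: the doubled namespace component is forced
set_option linter.dupNamespace false

namespace Summit.ResolutionOfSingularities.ResolutionOfSingularities.Theorems.FRationalResolution.GradedUnitSplitting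

universe u v w w'

variable {k : Type u} [CommRing k] {B : Type w} [DecidableEq B] [AddCommGroup B] {T : Type v}
  [CommRing T] [Algebra k T] (𝒯 : B → Submodule k T) [GradedAlgebra 𝒯]

/-- **Multiplicative choice of homogeneous units along a free lattice.** Let `M` be a free
`ℤ`-module, `d : M →+ B`, and suppose every degree `d m` carries a homogeneous unit of `T`.
Then there is a homomorphism `λ : M →+ Additive Tˣ` with `λ(m) ∈ T_{d m}` for every `m`.
[folklore; cite: SGA3, Exp. VIII §4–5] -/
theorem exists_unitHom_mem_grade {M : Type w'} [AddCommGroup M] [Module.Free ℤ M] (d : M →+ B)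
    (hunits : ∀ m : M, ∃ u ∈ 𝒯 (d m), IsUnit u) :
    ∃ lam : M →+ Additive Tˣ, ∀ m : M, ((Additive.toMul (lam m) : Tˣ) : T) ∈ 𝒯 (d m) := by
  classical
  let bM := Module.Free.chooseBasis ℤ M
  -- units on the basis
  choose u hu huunit using hunits
  let U : Module.Free.ChooseBasisIndex ℤ M → Additive Tˣ :=
    fun i => Additive.ofMul (huunit (bM i)).unit
  let lam : M →ₗ[ℤ] Additive Tˣ := bM.constr ℤ U
  refine ⟨lam.toAddMonoidHom, ?_⟩
  -- the good set is a subgroup containing the basis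
  let G : AddSubgroup M :=
    { carrier := {m | ((Additive.toMul (lam m) : Tˣ) : T) ∈ 𝒯 (d m)}
      zero_mem' := by
        simp only [Set.mem_setOf_eq, map_zero, toMul_zero, Units.val_one]
        exact SetLike.one_mem_graded 𝒯
      add_mem' := by
        intro m m' hm hm'
        simp only [Set.mem_setOf_eq, map_add, toMul_add, Units.val_mul]
        exact SetLike.mul_mem_graded hm hm'
      neg_mem' := by
        intro m hm
        simp only [Set.mem_setOf_eq, map_neg, toMul_neg]
        have h := HomogeneousUnits.inv_mem_of_isUnit 𝒯 hm
          (Units.mul_inv (Additive.toMul (lam m)))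
        exact h }
  have hbasis : ∀ i, bM i ∈ G := by
    intro i
    show ((Additive.toMul (lam (bM i)) : Tˣ) : T) ∈ 𝒯 (d (bM i))
    have h : lam (bM i) = U i := bM.constr_basis ℤ U i
    rw [h]
    show (((huunit (bM i)).unit : Tˣ) : T) ∈ 𝒯 (d (bM i))
    rw [IsUnit.unit_spec]
    exact hu (bM i)
  have hG : ∀ m, m ∈ G := by
    intro m
    have hspan : m ∈ Submodule.span ℤ (Set.range bM) := by rw [bM.span_eq]; trivial
    have hle : Submodule.span ℤ (Set.range bM) ≤ G.toIntSubmodule := by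
      rw [Submodule.span_le]
      rintro _ ⟨i, rfl⟩
      exact hbasis i
    exact hle hspan
  intro m
  exact hG m

end Summit.ResolutionOfSingularities.ResolutionOfSingularities.Theorems.FRationalResolution.GradedUnitSplitting

end
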